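import Summits.KontsevichZagierPeriods.KontsevichZagierPeriods.Theses.EqualShadows
import Summits.KontsevichZagierPeriods.KontsevichZagierPeriods.Theorems.MellinCoareaSummitImpliesTransfer
import Literature.NumberTheory.Transcendental.KZCalculusProofs

/-!
# `Assembly` (stmt-KontsevichZagierPeriods-10286, route EqualShadows) — proof

The route's assembly item

  `RelEquiSlice → RelTransferOne → SweepDescent → KontsevichZagierPeriods`

(downward induction on the fibre dimension, `k = 1` respelling, padding to `b = 0`). The route's
deciding theorem `closes` takes `Assembly` itself as its fourth hypothesis, so the item is a genuine
(if purely logical and measure-theoretic) lemma, proved here: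

1. **Conjecture 1 in families at every fibre dimension `k ≥ 1`** — for all `b` and all
   `s s' : KZ.IntegralRep (b + k)` whose fibre integrals `∫_{y ∈ ℝᵏ : (x,y) ∈ σ} f (x,y) dy` agree
   for a.e. base point `x ∈ ℝᵇ`, `KZ.Equivalent s s'` — by induction on `k` (`Nat.le_induction`):
   `k = 1` is the crux `RelTransferOne`, whose fibre integrals are written over `t ∈ ℝ` with
   `Fin.snoc x t` instead of `y ∈ ℝ¹` with `Fin.append x y` (`setIntegral_fibre_fin_one`: transport
   along the volume-preserving `MeasurableEquiv.funUnique (Fin 1) ℝ`, `Fin.append_right_eq_snoc`);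
   `k + 1 ⇒ k + 2` is the support item `SweepDescent` at `(b, k)`, fed with the sweeps of the crux
   `RelEquiSlice` and with the induction hypothesis at base dimension `b + 1`.
2. **Padding to `b = 0`.** Over the trivial base `ℝ⁰` (whose volume is a Dirac mass,
   `MeasureTheory.Measure.volume_pi_eq_dirac`) the fibre integral of `s : KZ.IntegralRep (0 + K)` is
   its value, by Fubini along `Fin.append`
   (`Summit.KontsevichZagierPeriods.MellinCoarea.value_eq_integral_fibreIntegral`, in tree).
3. Given rational-shape `r`, `r'` of dimensions `n`, `m` with equal values, raise both by slabs
   (Newton–Leibniz moves, `KZ.IntegralRep.exists_equivalent_of_le`; values are kept by soundness,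
   `KZ.Equivalent.value_eq_holds`) to the common dimension `0 + (n + m + 1)`, apply (1) with
   `b = 0`, `k = n + m + 1` through (2), and compose the equivalences. The rationality hypotheses
   are not used (the cruxes are stated for all representations).

The three antecedents are the route's open cruxes/support item and are NOT discharged here: the
theorem is the implication, nothing more. (Lead c10 of crux stmt-KontsevichZagierPeriods-9129,
banking.) No definitions are introduced.

References: M. Kontsevich, D. Zagier, *Periods* (2001), §1.2, Conjecture 1; A. Huber,
S. Müller-Stach, *Periods and Nori Motives* (2017), §13.1.
-/

namespace Summit.KontsevichZagierPeriods.EqualShadows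

open MeasureTheory
open Literature.NumberTheory.Transcendental

/-- **The `k = 1` respelling.** Over a base point `x ∈ ℝᵇ`, the fibre integral of a
representation of dimension `b + 1` over the last coordinate written with `Fin.append x y`,
`y ∈ ℝ¹`, equals the one written with `Fin.snoc x t`, `t ∈ ℝ` (transport along the
volume-preserving `MeasurableEquiv.funUnique (Fin 1) ℝ`, and `Fin.append x y = Fin.snoc x (y 0)`).
[folklore] -/
theorem setIntegral_fibre_fin_one {b : ℕ} (r : KZ.IntegralRep (b + 1)) (x : Fin b → ℝ) :
    ∫ y in {y : Fin 1 → ℝ | Fin.append x y ∈ r.domain}, r.integrand (Fin.append x y) =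
      ∫ t in {t : ℝ | (Fin.snoc x t : Fin (b + 1) → ℝ) ∈ r.domain}, r.integrand (Fin.snoc x t) := by
  have h := (volume_preserving_funUnique (Fin 1) ℝ).setIntegral_preimage_emb
    (MeasurableEquiv.funUnique (Fin 1) ℝ).measurableEmbedding
    (fun t => r.integrand (Fin.snoc x t)) {t : ℝ | (Fin.snoc x t : Fin (b + 1) → ℝ) ∈ r.domain}
  have he : ∀ y : Fin 1 → ℝ, MeasurableEquiv.funUnique (Fin 1) ℝ y = y 0 := fun y => rfl
  rw [← h]
  simp only [Fin.append_right_eq_snoc, Set.preimage_setOf_eq, he]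
  rfl

/-- **Assembly of route EqualShadows** (stmt-KontsevichZagierPeriods-10286):
`RelEquiSlice → RelTransferOne → SweepDescent → KontsevichZagierPeriods`. Conjecture 1 in families
holds at every fibre dimension `k ≥ 1` by induction on `k` (`k = 1`: `RelTransferOne`, respelled
from `Fin.append` to `Fin.snoc` by `setIntegral_fibre_fin_one`; step: `SweepDescent` fed by the
sweeps of `RelEquiSlice`); two rational-shape representations with equal values are padded by
slabs to the common dimension `0 + (n + m + 1)` (`KZ.IntegralRep.exists_equivalent_of_le`, values
kept by `KZ.Equivalent.value_eq_holds`), where over the base `ℝ⁰` the fibre integral is the value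
(`MellinCoarea.value_eq_integral_fibreIntegral`, Dirac volume on `ℝ⁰`), so the family statement
at `b = 0` makes them KZ-equivalent. [Kontsevich–Zagier 2001, §1.2] [folklore] -/
theorem assembly_proof :
    Summit.KontsevichZagierPeriods.KontsevichZagierPeriods.Theses.EqualShadows.Assembly := by
  intro h₁ h₂ h₃ n m r r' _ _ hv
  -- (1) Conjecture 1 in families at every fibre dimension `k ≥ 1`, by induction on `k`:
  -- `k = 1` is `RelTransferOne` (respelled); `k + 1 ⇒ k + 2` is `SweepDescent` fed by the sweeps
  -- of `RelEquiSlice` and by the induction hypothesis over the base `ℝᵇ⁺¹`.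
  have P : ∀ k, 1 ≤ k → ∀ b (s s' : KZ.IntegralRep (b + k)),
      (∀ᵐ x : (Fin b → ℝ), (∫ y in {y : Fin k → ℝ | Fin.append x y ∈ s.domain},
        s.integrand (Fin.append x y)) = ∫ y in {y : Fin k → ℝ | Fin.append x y ∈ s'.domain},
        s'.integrand (Fin.append x y)) → KZ.Equivalent s s' := by
    intro k hk
    induction k, hk using Nat.le_induction with
    | base =>
      intro b s s' hfib
      refine h₂ s s' ?_
      filter_upwards [hfib] with x hx
      rwa [setIntegral_fibre_fin_one s x, setIntegral_fibre_fin_one s' x] at hx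
    | succ k hk ih =>
      obtain ⟨k, rfl⟩ : ∃ k', k = k' + 1 := ⟨k - 1, by omega⟩
      intro b s s' hfib
      exact h₃ s s' hfib (h₁ s s' hfib) (ih (b + 1))
  -- (2) over the trivial base `ℝ⁰` the fibre integral is the value (Fubini along `Fin.append`,
  -- and the volume of `ℝ⁰` is a Dirac mass)
  have hfib0 : ∀ (K : ℕ) (s : KZ.IntegralRep (0 + K)) (x : Fin 0 → ℝ),
      ∫ y in {y : Fin K → ℝ | Fin.append x y ∈ s.domain}, s.integrand (Fin.append x y) =
        s.value := by
    intro K s x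
    rw [Summit.KontsevichZagierPeriods.MellinCoarea.value_eq_integral_fibreIntegral (b := 0)
      (k := K) s, Measure.volume_pi_eq_dirac x, integral_dirac]
  -- (3) pad both representations to the common dimension `0 + (n + m + 1)` (slabs are moves)
  obtain ⟨R, hR⟩ := r.exists_equivalent_of_le (N := 0 + (n + m + 1)) (by omega)
  obtain ⟨R', hR'⟩ := r'.exists_equivalent_of_le (N := 0 + (n + m + 1)) (by omega)
  have hval : R.value = R'.value := by
    rw [← KZ.Equivalent.value_eq_holds hR, ← KZ.Equivalent.value_eq_holds hR', hv]
  have hRR' : KZ.Equivalent R R' :=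
    P (n + m + 1) (Nat.succ_le_succ (Nat.zero_le _)) 0 R R'
      (Filter.Eventually.of_forall fun x => by rw [hfib0 _ R x, hfib0 _ R' x, hval])
  exact hR.trans (hRR'.trans hR'.symm)

end Summit.KontsevichZagierPeriods.EqualShadows
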